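/-
Copyright: cell gate-hubbard-kl, typer seat t6 (D-0069 (2) B1 statement-typer wave). Proof file: discharges the named
fact `Lemma4SectorSliceNorm` of `FermiRG/DR2000PartI.lean`; nothing here is a claim about the Hubbard model or about
superconductivity.
-/
import Mathlib
import Literature.MathematicalPhysics.QuantumLattice.FermiRG.DR2000PartI
import HarnessLib

/-!
# Disertori–Rivasseau 2000, Part I, §IV.1 Lemma 4 — PROVED: the sector/slice norm bound (IV.11)

M. Disertori, V. Rivasseau, *Interacting Fermi liquid in two dimensions at finite temperature. Part I: Convergent
Attributions*, Commun. Math. Phys. **215** (2000) 251–290, arXiv:cond-mat/9907130 [DisertoriRivasseau2000], §IV.1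
Lemma 4, displays (IV.7)–(IV.13), render `paper:arxiv-cond-mat_9907130` p0012:L157–208 (LOCATOR = chunk:line of the
corpus-TeX render).  This file discharges the named fact
`Literature.MathematicalPhysics.QuantumLattice.FermiRG.DR2000.Lemma4SectorSliceNorm` (cell FACT-LIST F-044, DAG row
DR1.L4) of the DEFINITION-FROZEN statement file `FermiRG/DR2000PartI.lean` WITHOUT touching that file:
`theorem Lemma4SectorSliceNorm_holds : Lemma4SectorSliceNorm` — for every cutoff `u` of (II.13) there is `K` with
`(T/(2π)²) Σ_n ∫d²k χ_θ(k⃗)² (k₀²+e²)^{-1/2} [u(r/Λ_M²) − u(r/Λ_m²)] ≤ K Λ_M^{1/2}(Λ_M − Λ_m)` for all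
`0 < T`, `√2πT ≤ Λ_m ≤ Λ_M ≤ 1`, all sector centres `θ`.

THE PRINTED ARGUMENT (p0012:L166–208) bounds the integrand on the momentum set `S` selected by the cutoffs by
`sup_S [χ · (−x^{1/2}u'(x))] ≤ K Λ^{−1/2}` and the size of that set by `|S| ≤ β Λ^{1/2}(w_M) Λ α^{−1}` ((IV.12)–(IV.13)),
after writing the slice cutoff as `∫ dΛ` of its Λ-derivative ((IV.9)–(IV.10)).  We follow the same two ingredients in
elementary form: (1) the SLICE factor — by the mean value theorem `|u(r/Λ_M²) − u(r/Λ_m²)| ≤ C_u (Λ_M − Λ_m)/Λ_M` on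
its support `Λ_m²/4 ≤ r ≤ Λ_M²/2` (split at `Λ_m = Λ_M/2`); (2) the SIZE of the sectorised shell with the weight
`(k₀²+e²)^{−1/2} ≤ √2 |k₀|^{−1/2}(|k₀|+|e|)^{−1/2}` — in polar coordinates the angular factor is `≤ 2Λ_M^{1/2}` (the
sector has angular width `Λ_M^{1/2}`, at most two of its `2π`-translates meet `(−π, π)`), the radial factor is
`∫_{|e|≤Λ_M} (|k₀|+|ρ−1|)^{−1/2} ≲ Λ_M^{1/2}` uniformly in `k₀`, and the Matsubara sum `T Σ_{|k₀|≤Λ_M} |k₀|^{−1/2}`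
is `≤ C Λ_M^{1/2}` (`Σ_{m≤N}(m+1)^{−1/2} ≤ 2√(N+1)`).  Product: `K Λ_M^{1/2}(Λ_M − Λ_m)`.  No definitions; all helpers are
`private`.
-/

noncomputable section

open MeasureTheory Set Filter
open scoped Topology BigOperators ENNReal

namespace Literature.MathematicalPhysics.QuantumLattice.FermiRG.DR2000

open Literature.MathematicalPhysics.QuantumLattice

/-! ## 1. The cutoff function: bounds, and the slice factor -/

/-- A cutoff of (II.13) is bounded together with its derivative. [folklore] -/
private theorem cutoff_bounds {u : ℝ → ℝ} (hu : IsCutoff u) :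
    ∃ M : ℝ, 1 ≤ M ∧ (∀ x, |u x| ≤ M) ∧ ∀ x, |deriv u x| ≤ M := by
  have hc : HasCompactSupport u := by
    refine HasCompactSupport.intro (isCompact_Icc : IsCompact (Icc (-(1 : ℝ)) 1)) fun x hx => hu.eq_zero x ?_
    rw [mem_Icc, not_and_or, not_le, not_le] at hx
    rcases hx with hx | hx
    · rw [abs_of_neg (by linarith)]; linarith
    · rw [abs_of_pos (by linarith)]; linarith
  obtain ⟨M₀, hM₀⟩ := hu.smooth.continuous.bounded_above_of_compact_support hc
  obtain ⟨M₁, hM₁⟩ := (hu.smooth.continuous_deriv (by simp)).bounded_above_of_compact_support hc.deriv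
  refine ⟨max 1 (max M₀ M₁), le_max_left _ _, fun x => ?_, fun x => ?_⟩
  · exact ((Real.norm_eq_abs _).symm.le.trans (hM₀ x)).trans ((le_max_left _ _).trans (le_max_right _ _))
  · exact ((Real.norm_eq_abs _).symm.le.trans (hM₁ x)).trans ((le_max_right _ _).trans (le_max_right _ _))

/-- Above the upper scale both cutoffs vanish: `u(r/Λ_M²) − u(r/Λ_m²) = 0` for `r > Λ_M²/2`.
[cite: DisertoriRivasseau2000, §II.2 (II.13) p0004:L12–16] -/
private theorem bandCutoff_eq_zero_of_lt {u : ℝ → ℝ} (hu : IsCutoff u) {Λm ΛM r : ℝ} (hm : 0 < Λm)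
    (hmM : Λm ≤ ΛM) (hr : ΛM ^ 2 / 2 < r) : bandCutoff u Λm ΛM r = 0 := by
  have hM : 0 < ΛM := hm.trans_le hmM
  have hr0 : 0 < r := lt_of_le_of_lt (by positivity) hr
  have h1 : u (r / ΛM ^ 2) = 0 := by
    apply hu.eq_zero
    rw [abs_of_pos (div_pos hr0 (by positivity)), lt_div_iff₀ (by positivity)]
    linarith
  have h2 : u (r / Λm ^ 2) = 0 := by
    apply hu.eq_zero
    rw [abs_of_pos (div_pos hr0 (by positivity)), lt_div_iff₀ (by positivity)]
    have : Λm ^ 2 ≤ ΛM ^ 2 := by gcongr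
    linarith
  simp [bandCutoff, h1, h2]

/-- Below the lower scale both cutoffs equal one: `u(r/Λ_M²) − u(r/Λ_m²) = 0` for `0 ≤ r < Λ_m²/4`.
[cite: DisertoriRivasseau2000, §II.2 (II.13) p0004:L12–16] -/
private theorem bandCutoff_eq_zero_of_small {u : ℝ → ℝ} (hu : IsCutoff u) {Λm ΛM r : ℝ} (hm : 0 < Λm)
    (hmM : Λm ≤ ΛM) (hr0 : 0 ≤ r) (hr : r < Λm ^ 2 / 4) : bandCutoff u Λm ΛM r = 0 := by
  have hM : 0 < ΛM := hm.trans_le hmM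
  have h2 : u (r / Λm ^ 2) = 1 := by
    apply hu.eq_one
    rw [abs_of_nonneg (by positivity), div_lt_iff₀ (by positivity)]
    linarith
  have h1 : u (r / ΛM ^ 2) = 1 := by
    apply hu.eq_one
    rw [abs_of_nonneg (by positivity), div_lt_iff₀ (by positivity)]
    have : Λm ^ 2 ≤ ΛM ^ 2 := by gcongr
    linarith
  simp [bandCutoff, h1, h2]

/-- **The slice factor.** For `0 < Λ_m ≤ Λ_M` and `r ≥ 0`, `|u(r/Λ_M²) − u(r/Λ_m²)| ≤ 4M (Λ_M − Λ_m)/Λ_M` where `M`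
bounds `|u|` and `|u'|` — the elementary form of (IV.9)–(IV.10) «∫_{Λ(w_M)}^{Λ(w_A)} dΛ (−x u'(x))».
[cite: DisertoriRivasseau2000, §IV.1 (IV.9)–(IV.10) p0012:L173–185] -/
private theorem abs_bandCutoff_le {u : ℝ → ℝ} (hu : IsCutoff u) {M : ℝ} (hM1 : 1 ≤ M) (hM₀ : ∀ x, |u x| ≤ M)
    (hM₁ : ∀ x, |deriv u x| ≤ M) {Λm ΛM r : ℝ} (hm : 0 < Λm) (hmM : Λm ≤ ΛM) (hr0 : 0 ≤ r) :
    |bandCutoff u Λm ΛM r| ≤ 4 * M * ((ΛM - Λm) / ΛM) := by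
  have hM : 0 < ΛM := hm.trans_le hmM
  have hMpos : 0 < M := by linarith
  have hfrac : 0 ≤ (ΛM - Λm) / ΛM := div_nonneg (by linarith) hM.le
  by_cases hr : ΛM ^ 2 / 2 < r
  · rw [bandCutoff_eq_zero_of_lt hu hm hmM hr, abs_zero]; positivity
  rw [not_lt] at hr
  by_cases hcase : ΛM < 2 * Λm
  · -- mean value theorem: `|u(a) − u(b)| ≤ M |a − b|`
    have hmvt : |u (r / ΛM ^ 2) - u (r / Λm ^ 2)| ≤ M * |r / ΛM ^ 2 - r / Λm ^ 2| := by
      have h := Convex.norm_image_sub_le_of_norm_deriv_le (f := u) (s := univ) (x := r / Λm ^ 2)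
        (y := r / ΛM ^ 2) (fun x _ => (hu.smooth.differentiable (by simp)).differentiableAt)
        (fun x _ => by rw [Real.norm_eq_abs]; exact hM₁ x) convex_univ (mem_univ _) (mem_univ _)
      simpa only [Real.norm_eq_abs] using h
    have hx : r / ΛM ^ 2 ≤ r / Λm ^ 2 := by
      apply div_le_div_of_nonneg_left hr0 (by positivity)
      gcongr
    have habs : |r / ΛM ^ 2 - r / Λm ^ 2| = r / Λm ^ 2 - r / ΛM ^ 2 := by
      rw [abs_of_nonpos (by linarith), neg_sub]
    have hkey : r / Λm ^ 2 - r / ΛM ^ 2 ≤ 4 * ((ΛM - Λm) / ΛM) := by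
      have h1 : r / Λm ^ 2 - r / ΛM ^ 2 = r * (ΛM ^ 2 - Λm ^ 2) / (Λm ^ 2 * ΛM ^ 2) := by
        rw [div_sub_div _ _ (by positivity) (by positivity)]
        congr 1
        ring
      have h2 : r * (ΛM ^ 2 - Λm ^ 2) ≤ ΛM ^ 2 / 2 * (ΛM ^ 2 - Λm ^ 2) :=
        mul_le_mul_of_nonneg_right hr (by nlinarith)
      have h6 : 0 ≤ ΛM - Λm := by linarith
      have h7 : ΛM * (ΛM + Λm) ≤ 8 * Λm ^ 2 := by
        have a1 : ΛM * ΛM ≤ 2 * Λm * ΛM := mul_le_mul_of_nonneg_right hcase.le hM.le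
        have a2 : ΛM * Λm ≤ 2 * Λm * Λm := mul_le_mul_of_nonneg_right hcase.le hm.le
        nlinarith
      have h8 : ΛM ^ 2 / 2 * (ΛM ^ 2 - Λm ^ 2) ≤ 4 * ((ΛM - Λm) / ΛM) * (Λm ^ 2 * ΛM ^ 2) := by
        have e1 : ΛM ^ 2 / 2 * (ΛM ^ 2 - Λm ^ 2) = (ΛM - Λm) * ΛM * (ΛM * (ΛM + Λm)) / 2 := by ring
        have e2 : 4 * ((ΛM - Λm) / ΛM) * (Λm ^ 2 * ΛM ^ 2) = (ΛM - Λm) * ΛM * (8 * Λm ^ 2) / 2 := by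
          field_simp
          ring
        rw [e1, e2]
        have := mul_le_mul_of_nonneg_left h7 (mul_nonneg h6 hM.le)
        linarith
      rw [h1, div_le_iff₀ (by positivity)]
      linarith
    unfold bandCutoff
    calc |u (r / ΛM ^ 2) - u (r / Λm ^ 2)| ≤ M * |r / ΛM ^ 2 - r / Λm ^ 2| := hmvt
      _ = M * (r / Λm ^ 2 - r / ΛM ^ 2) := by rw [habs]
      _ ≤ M * (4 * ((ΛM - Λm) / ΛM)) := mul_le_mul_of_nonneg_left hkey hMpos.le
      _ = 4 * M * ((ΛM - Λm) / ΛM) := by ring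
  · -- crude bound `2M`, and `(Λ_M − Λ_m)/Λ_M ≥ 1/2`
    rw [not_lt] at hcase
    have hhalf : (1 : ℝ) / 2 ≤ (ΛM - Λm) / ΛM := by
      rw [div_le_div_iff₀ (by norm_num) hM]; linarith
    unfold bandCutoff
    calc |u (r / ΛM ^ 2) - u (r / Λm ^ 2)| ≤ |u (r / ΛM ^ 2)| + |u (r / Λm ^ 2)| := abs_sub _ _
      _ ≤ M + M := add_le_add (hM₀ _) (hM₀ _)
      _ = 4 * M * (1 / 2) := by ring
      _ ≤ 4 * M * ((ΛM - Λm) / ΛM) := mul_le_mul_of_nonneg_left hhalf (by positivity)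

/-! ## 2. The periodised sector cutoff: size and angular support -/

/-- For a period `τ > 1`, the translates `u(y − mτ)` of a function supported in `[−1/2, 1/2]` have disjoint supports:
if `|y − mτ| ≤ 1/2` then every other translate vanishes at `y`. [folklore] -/
private theorem translate_eq_zero {u : ℝ → ℝ} (hu : IsCutoff u) {τ y : ℝ} (hτ : 1 < τ) {m m' : ℤ}
    (hm : |y - m * τ| ≤ 1 / 2) (hne : m' ≠ m) : u (y - m' * τ) = 0 := by
  apply hu.eq_zero
  by_contra hcon
  rw [not_lt] at hcon
  have h1 : |((m : ℝ) - m') * τ| ≤ 1 := by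
    have : ((m : ℝ) - m') * τ = (y - m' * τ) - (y - m * τ) := by ring
    rw [this]
    exact (abs_sub _ _).trans (by linarith)
  have h2 : (1 : ℝ) ≤ |((m : ℝ) - m')| := by
    rw [← Int.cast_sub, ← Int.cast_abs]
    exact_mod_cast Int.one_le_abs (sub_ne_zero.2 (Ne.symm hne))
  have h3 : τ ≤ |((m : ℝ) - m') * τ| := by
    rw [abs_mul, abs_of_pos (by linarith : (0 : ℝ) < τ)]
    exact le_mul_of_one_le_left (by linarith) h2
  linarith

/-- The periodisation is pointwise bounded by `sup|u|` (at most one translate is nonzero), and it vanishes unless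
`|y − mτ| ≤ 1/2` for some `m`. [cite: DisertoriRivasseau2000, §III.3.1 (III.11) p0009:L66–70] -/
private theorem periodise_abs_le_and_support {u : ℝ → ℝ} (hu : IsCutoff u) {M : ℝ} (hM : 0 ≤ M)
    (hM₀ : ∀ x, |u x| ≤ M) {τ : ℝ} (hτ : 1 < τ) (y : ℝ) :
    |periodise u τ y| ≤ M ∧ (periodise u τ y ≠ 0 → ∃ m : ℤ, |y - m * τ| ≤ 1 / 2) := by
  by_cases h : ∃ m : ℤ, |y - m * τ| ≤ 1 / 2
  · obtain ⟨m, hm⟩ := h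
    have heq : periodise u τ y = u (y - m * τ) := by
      unfold periodise
      exact tsum_eq_single m fun m' hm' => translate_eq_zero hu hτ hm hm'
    rw [heq]
    exact ⟨hM₀ _, fun _ => ⟨m, hm⟩⟩
  · push Not at h
    have heq : periodise u τ y = 0 := by
      unfold periodise
      have : (fun n : ℤ => u (y - n * τ)) = fun _ => 0 := funext fun n => hu.eq_zero _ (h n)
      rw [this, tsum_zero]
    rw [heq, abs_zero]
    exact ⟨hM, fun h0 => (h0 rfl).elim⟩

/-- The sector cutoff `χ_{α,θ_s}(θ)²` is bounded by `M² · 1_E(θ)`, `E` = the `2π`-periodic family of arcs of half-width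
`1/(2α^{1/4})` around `θ_s`. [cite: DisertoriRivasseau2000, §III.3.1 p0009:L57–78] -/
private theorem sectorChi_sq_le {u : ℝ → ℝ} (hu : IsCutoff u) {M : ℝ} (hM : 0 ≤ M) (hM₀ : ∀ x, |u x| ≤ M)
    {w : ℝ} (hw : 0 < w) (hτ : 1 < 2 * Real.pi * w) (θs θ : ℝ) {αs : ℝ} (hα : αs ^ (1 / 4 : ℝ) = w) :
    sectorChi u αs θs θ ^ 2 ≤
      M ^ 2 * Set.indicator {θ : ℝ | ∃ m : ℤ, |θ - θs - 2 * Real.pi * m| ≤ 1 / (2 * w)} (fun _ => (1 : ℝ)) θ := by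
  unfold sectorChi
  rw [hα]
  obtain ⟨hb, hs⟩ := periodise_abs_le_and_support hu hM hM₀ hτ (w * (θ - θs))
  by_cases h0 : periodise u (2 * Real.pi * w) (w * (θ - θs)) = 0
  · rw [h0, zero_pow two_ne_zero]
    exact mul_nonneg (sq_nonneg M) (Set.indicator_nonneg (fun _ _ => zero_le_one) _)
  · obtain ⟨m, hm⟩ := hs h0
    have hmem : θ ∈ {θ : ℝ | ∃ m : ℤ, |θ - θs - 2 * Real.pi * m| ≤ 1 / (2 * w)} := by
      refine ⟨m, ?_⟩
      have h1 : w * (θ - θs) - m * (2 * Real.pi * w) = w * (θ - θs - 2 * Real.pi * m) := by ring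
      rw [h1, abs_mul, abs_of_pos hw] at hm
      rw [le_div_iff₀ (by positivity)]
      linarith
    rw [Set.indicator_of_mem hmem, mul_one]
    calc periodise u (2 * Real.pi * w) (w * (θ - θs)) ^ 2
        = |periodise u (2 * Real.pi * w) (w * (θ - θs))| ^ 2 := (sq_abs _).symm
      _ ≤ M ^ 2 := pow_le_pow_left₀ (abs_nonneg _) hb 2

/-- **The angular support.** The arcs of half-width `h ≤ 1/2` around the `2π`-translates of `θ_s` meet `(−π, π)` in a
set of measure `≤ 4h`: at most two translates are involved. [cite: DisertoriRivasseau2000, §IV.1 (IV.13) p0012:L208] -/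
private theorem volume_arcs_inter_le (θs : ℝ) {h : ℝ} (hh0 : 0 ≤ h) (hh : h ≤ 1 / 2) :
    volume ({θ : ℝ | ∃ m : ℤ, |θ - θs - 2 * Real.pi * m| ≤ h} ∩ Ioo (-Real.pi) Real.pi) ≤
      ENNReal.ofReal (4 * h) := by
  have hπ : 0 < Real.pi := Real.pi_pos
  have hπ3 : 3 < Real.pi := Real.pi_gt_three
  -- the only translates meeting `(−π, π)` are `m₀` and `m₀ + 1`, `m₀ = ⌊L⌋ + 1`, `L = (−π − h − θ_s)/(2π)`
  set L : ℝ := (-Real.pi - h - θs) / (2 * Real.pi) with hL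
  set m₀ : ℤ := ⌊L⌋ + 1 with hm₀
  set c : ℤ → ℝ := fun m => θs + 2 * Real.pi * m with hc
  have hsub : {θ : ℝ | ∃ m : ℤ, |θ - θs - 2 * Real.pi * m| ≤ h} ∩ Ioo (-Real.pi) Real.pi ⊆
      Icc (c m₀ - h) (c m₀ + h) ∪ Icc (c (m₀ + 1) - h) (c (m₀ + 1) + h) := by
    rintro θ ⟨⟨m, hm⟩, hθ1, hθ2⟩
    rw [abs_le] at hm
    -- `L < m < L + 2`
    have hm1 : L < m := by
      rw [hL, div_lt_iff₀ (by positivity)]; linarith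
    have hm2 : (m : ℝ) < L + 2 := by
      rw [hL, div_add' _ _ _ (by positivity), lt_div_iff₀ (by positivity)]; nlinarith
    have hm3 : m₀ ≤ m := by
      rw [hm₀]
      have : (⌊L⌋ : ℝ) < m := (Int.floor_le L).trans_lt hm1
      exact_mod_cast (show ⌊L⌋ < m by exact_mod_cast this)
    have hm4 : m ≤ m₀ + 1 := by
      rw [hm₀]
      have : (m : ℝ) < ⌊L⌋ + 3 := by linarith [Int.lt_floor_add_one L]
      have : m < ⌊L⌋ + 3 := by exact_mod_cast this
      omega
    rcases (show m = m₀ ∨ m = m₀ + 1 by omega) with rfl | rfl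
    · left; exact ⟨by simp only [hc]; linarith, by simp only [hc]; linarith⟩
    · right
      push_cast at hm hm1 hm2 ⊢
      exact ⟨by simp only [hc]; push_cast; linarith, by simp only [hc]; push_cast; linarith⟩
  calc volume ({θ : ℝ | ∃ m : ℤ, |θ - θs - 2 * Real.pi * m| ≤ h} ∩ Ioo (-Real.pi) Real.pi)
      ≤ volume (Icc (c m₀ - h) (c m₀ + h) ∪ Icc (c (m₀ + 1) - h) (c (m₀ + 1) + h)) := measure_mono hsub
    _ ≤ volume (Icc (c m₀ - h) (c m₀ + h)) + volume (Icc (c (m₀ + 1) - h) (c (m₀ + 1) + h)) :=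
        measure_union_le _ _
    _ = ENNReal.ofReal (4 * h) := by
        rw [Real.volume_Icc, Real.volume_Icc, ← ENNReal.ofReal_add (by linarith) (by linarith)]
        congr 1; ring

/-! ## 3. The radial factor and the Matsubara sum -/

/-- `√(c + a) − √c ≤ √a` for `c, a ≥ 0`. [folklore] -/
private theorem sqrt_add_sub_sqrt_le {c a : ℝ} (hc : 0 ≤ c) (ha : 0 ≤ a) :
    Real.sqrt (c + a) - Real.sqrt c ≤ Real.sqrt a := by
  have key : c + a ≤ (Real.sqrt c + Real.sqrt a) ^ 2 := by
    rw [add_sq, Real.sq_sqrt hc, Real.sq_sqrt ha]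
    nlinarith [Real.sqrt_nonneg a, Real.sqrt_nonneg c]
  have h := Real.sqrt_le_sqrt key
  rw [Real.sqrt_sq (by positivity)] at h
  linarith

/-- **The radial factor**: for `c > 0` and `0 ≤ a`, `∫_{1−a}^{1+a} (c + |ρ − 1|)^{−1/2} dρ = 4(√(c+a) − √c) ≤ 4√a`, stated
on the two halves. [cite: DisertoriRivasseau2000, §IV.1 (IV.10) p0012:L186–194] -/
private theorem integral_inv_sqrt_right {c a : ℝ} (hc : 0 < c) (ha : 0 ≤ a) :
    ∫ ρ in (1 : ℝ)..1 + a, 1 / Real.sqrt (c + (ρ - 1)) = 2 * Real.sqrt (c + a) - 2 * Real.sqrt c := by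
  have hderiv : ∀ ρ ∈ uIcc (1 : ℝ) (1 + a),
      HasDerivAt (fun ρ => 2 * Real.sqrt (c + (ρ - 1))) (1 / Real.sqrt (c + (ρ - 1))) ρ := by
    intro ρ hρ
    rw [uIcc_of_le (by linarith), mem_Icc] at hρ
    have hpos : 0 < c + (ρ - 1) := by linarith
    have h1 : HasDerivAt (fun ρ => c + (ρ - 1)) 1 ρ := by
      simpa using ((hasDerivAt_id ρ).sub_const 1).const_add c
    have hs : Real.sqrt (c + (ρ - 1)) ≠ 0 := (Real.sqrt_pos.2 hpos).ne'
    refine ((h1.sqrt hpos.ne').const_mul 2).congr_deriv ?_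
    field_simp
  rw [intervalIntegral.integral_eq_sub_of_hasDerivAt hderiv]
  · simp only [sub_self, add_zero, add_sub_cancel_left]
  · apply ContinuousOn.intervalIntegrable
    rw [uIcc_of_le (by linarith)]
    refine continuousOn_const.div ?_ fun ρ hρ => ?_
    · exact (Real.continuous_sqrt.comp (continuous_const.add (continuous_id.sub continuous_const))).continuousOn
    · rw [mem_Icc] at hρ
      exact (Real.sqrt_pos.2 (by linarith)).ne'

/-- [cite: DisertoriRivasseau2000, §IV.1 (IV.10) p0012:L186–194] -/
private theorem integral_inv_sqrt_left {c a : ℝ} (hc : 0 < c) (ha : 0 ≤ a) :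
    ∫ ρ in (1 - a : ℝ)..1, 1 / Real.sqrt (c + (1 - ρ)) = 2 * Real.sqrt (c + a) - 2 * Real.sqrt c := by
  have hderiv : ∀ ρ ∈ uIcc (1 - a : ℝ) 1,
      HasDerivAt (fun ρ => -(2 * Real.sqrt (c + (1 - ρ)))) (1 / Real.sqrt (c + (1 - ρ))) ρ := by
    intro ρ hρ
    rw [uIcc_of_le (by linarith), mem_Icc] at hρ
    have hpos : 0 < c + (1 - ρ) := by linarith
    have h1 : HasDerivAt (fun ρ => c + (1 - ρ)) (-1) ρ := by
      simpa using ((hasDerivAt_id ρ).const_sub 1).const_add c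
    have hs : Real.sqrt (c + (1 - ρ)) ≠ 0 := (Real.sqrt_pos.2 hpos).ne'
    refine (((h1.sqrt hpos.ne').const_mul 2).neg).congr_deriv ?_
    field_simp
  rw [intervalIntegral.integral_eq_sub_of_hasDerivAt hderiv]
  · simp only [sub_self, add_zero, sub_sub_cancel]
    ring
  · apply ContinuousOn.intervalIntegrable
    rw [uIcc_of_le (by linarith)]
    refine continuousOn_const.div ?_ fun ρ hρ => ?_
    · exact (Real.continuous_sqrt.comp (continuous_const.add (continuous_const.sub continuous_id))).continuousOn
    · rw [mem_Icc] at hρ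
      exact (Real.sqrt_pos.2 (by linarith)).ne'

/-- `Σ_{m=0}^{N} (m+1)^{−1/2} ≤ 2√(N+1)`. [folklore] -/
private theorem sum_inv_sqrt_le (N : ℕ) :
    ∑ m ∈ Finset.range (N + 1), 1 / Real.sqrt ((m : ℝ) + 1) ≤ 2 * Real.sqrt ((N : ℝ) + 1) := by
  induction N with
  | zero => simp
  | succ N ih =>
    rw [Finset.sum_range_succ]
    push_cast
    have h1 : 0 < Real.sqrt ((N : ℝ) + 1) := Real.sqrt_pos.2 (by positivity)
    have h2 : 0 < Real.sqrt ((N : ℝ) + 1 + 1) := Real.sqrt_pos.2 (by positivity)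
    -- `1/√(N+2) ≤ 2(√(N+2) − √(N+1))`
    have h3 : 1 / Real.sqrt ((N : ℝ) + 1 + 1) ≤ 2 * Real.sqrt ((N : ℝ) + 1 + 1) - 2 * Real.sqrt ((N : ℝ) + 1) := by
      rw [div_le_iff₀ h2]
      have h4 : Real.sqrt ((N : ℝ) + 1) * Real.sqrt ((N : ℝ) + 1 + 1) ≤ (N : ℝ) + 1 + 1 / 2 := by
        have := Real.sqrt_le_sqrt (show ((N : ℝ) + 1) * ((N : ℝ) + 1 + 1) ≤ ((N : ℝ) + 1 + 1 / 2) ^ 2 by nlinarith)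
        rwa [Real.sqrt_mul (by positivity), Real.sqrt_sq (by positivity)] at this
      nlinarith [Real.sq_sqrt (show (0 : ℝ) ≤ (N : ℝ) + 1 + 1 by positivity),
        Real.sq_sqrt (show (0 : ℝ) ≤ (N : ℝ) + 1 by positivity)]
    linarith


/-- **The radial factor in polar coordinates**: for `c > 0`, `0 ≤ a ≤ 1`,
`∫_{ρ>0} ρ · 1[|ρ²−1| ≤ a] (c + |ρ²−1|)^{−1/2} dρ ≤ 6√a`. [cite: DisertoriRivasseau2000, §IV.1 (IV.10)–(IV.13) p0012:L186–208] -/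
private theorem lintegral_radial_le {c a : ℝ} (hc : 0 < c) (ha0 : 0 ≤ a) (ha1 : a ≤ 1) :
    ∫⁻ ρ in Ioi (0 : ℝ), ENNReal.ofReal
        (ρ * (Icc (-a) a).indicator (fun e => 1 / Real.sqrt (c + |e|)) (ρ ^ 2 - 1)) ≤
      ENNReal.ofReal (6 * Real.sqrt a) := by
  -- pointwise: `ρ · 1[|ρ²−1| ≤ a]/√(c+|ρ²−1|) ≤ (3/2) · 1[|ρ−1| ≤ a]/√(c+|ρ−1|)` for `ρ > 0`
  set G : ℝ → ℝ := fun ρ => (3 / 2 : ℝ) * (Icc (1 - a) (1 + a)).indicator (fun ρ => 1 / Real.sqrt (c + |ρ - 1|)) ρ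
    with hGdef
  have hG0 : ∀ ρ, 0 ≤ G ρ := fun ρ => by
    simp only [hGdef]
    exact mul_nonneg (by norm_num) (Set.indicator_nonneg (fun _ _ => by positivity) _)
  have hpt : ∀ ρ : ℝ, 0 < ρ →
      ρ * (Icc (-a) a).indicator (fun e => 1 / Real.sqrt (c + |e|)) (ρ ^ 2 - 1) ≤ G ρ := by
    intro ρ hρ
    by_cases hmem : ρ ^ 2 - 1 ∈ Icc (-a) a
    · rw [Set.indicator_of_mem hmem]
      rw [mem_Icc] at hmem
      have hρ1 : ρ ≤ 3 / 2 := by nlinarith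
      have habs1 : |ρ - 1| ≤ |ρ ^ 2 - 1| := by
        rw [show ρ ^ 2 - 1 = (ρ - 1) * (ρ + 1) by ring, abs_mul]
        exact le_mul_of_one_le_right (abs_nonneg _) (by rw [abs_of_pos (by linarith)]; linarith)
      have habs2 : |ρ ^ 2 - 1| ≤ a := abs_le.2 ⟨hmem.1, hmem.2⟩
      have hmem' : ρ ∈ Icc (1 - a) (1 + a) := by
        have := abs_le.1 (habs1.trans habs2); exact ⟨by linarith [this.1], by linarith [this.2]⟩
      simp only [hGdef, Set.indicator_of_mem hmem']
      have hs1 : 0 < Real.sqrt (c + |ρ - 1|) := Real.sqrt_pos.2 (by positivity)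
      have hsq : Real.sqrt (c + |ρ - 1|) ≤ Real.sqrt (c + |ρ ^ 2 - 1|) := Real.sqrt_le_sqrt (by linarith)
      calc ρ * (1 / Real.sqrt (c + |ρ ^ 2 - 1|)) ≤ (3 / 2) * (1 / Real.sqrt (c + |ρ - 1|)) :=
            mul_le_mul hρ1 (one_div_le_one_div_of_le hs1 hsq) (by positivity) (by norm_num)
        _ = (3 / 2) * (1 / Real.sqrt (c + |ρ - 1|)) := rfl
    · rw [Set.indicator_of_notMem hmem, mul_zero]; exact hG0 ρ
  -- integrate the majorant over the whole line
  have hcont1 : ContinuousOn (fun ρ : ℝ => 1 / Real.sqrt (c + |ρ - 1|)) (Icc (1 - a) (1 + a)) := by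
    refine continuousOn_const.div ?_ fun ρ _ => (Real.sqrt_pos.2 (by positivity)).ne'
    exact (Real.continuous_sqrt.comp (continuous_const.add ((continuous_id.sub continuous_const).abs))).continuousOn
  have hGint : Integrable G := by
    simp only [hGdef]
    exact ((integrable_indicator_iff measurableSet_Icc).2 (hcont1.integrableOn_compact isCompact_Icc)).const_mul _
  calc ∫⁻ ρ in Ioi (0 : ℝ), ENNReal.ofReal (ρ * (Icc (-a) a).indicator (fun e => 1 / Real.sqrt (c + |e|)) (ρ ^ 2 - 1))
      ≤ ∫⁻ ρ in Ioi (0 : ℝ), ENNReal.ofReal (G ρ) :=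
        setLIntegral_mono' measurableSet_Ioi fun ρ hρ => ENNReal.ofReal_le_ofReal (hpt ρ hρ)
    _ ≤ ∫⁻ ρ, ENNReal.ofReal (G ρ) := setLIntegral_le_lintegral _ _
    _ = ENNReal.ofReal (∫ ρ, G ρ) :=
        (ofReal_integral_eq_lintegral_ofReal hGint (Filter.Eventually.of_forall hG0)).symm
    _ ≤ ENNReal.ofReal (6 * Real.sqrt a) := ENNReal.ofReal_le_ofReal ?_
  -- `∫ G = (3/2)(∫_{1−a}^{1} + ∫_{1}^{1+a}) = 6(√(c+a) − √c) ≤ 6√a`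
  simp only [hGdef, integral_const_mul]
  rw [integral_indicator measurableSet_Icc, integral_Icc_eq_integral_Ioc,
    ← intervalIntegral.integral_of_le (by linarith),
    ← intervalIntegral.integral_add_adjacent_intervals (b := (1 : ℝ))
      ((hcont1.mono (Icc_subset_Icc le_rfl (by linarith))).intervalIntegrable_of_Icc (by linarith))
      ((hcont1.mono (Icc_subset_Icc (by linarith) le_rfl)).intervalIntegrable_of_Icc (by linarith))]
  have hleft : ∫ ρ in (1 - a : ℝ)..1, 1 / Real.sqrt (c + |ρ - 1|) = 2 * Real.sqrt (c + a) - 2 * Real.sqrt c := by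
    rw [← integral_inv_sqrt_left hc ha0]
    refine intervalIntegral.integral_congr fun ρ hρ => ?_
    rw [uIcc_of_le (by linarith), mem_Icc] at hρ
    simp only [abs_of_nonpos (show ρ - 1 ≤ 0 by linarith), neg_sub]
  have hright : ∫ ρ in (1 : ℝ)..1 + a, 1 / Real.sqrt (c + |ρ - 1|) = 2 * Real.sqrt (c + a) - 2 * Real.sqrt c := by
    rw [← integral_inv_sqrt_right hc ha0]
    refine intervalIntegral.integral_congr fun ρ hρ => ?_
    rw [uIcc_of_le (by linarith), mem_Icc] at hρ
    simp only [abs_of_nonneg (show 0 ≤ ρ - 1 by linarith)]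
  rw [hleft, hright]
  have := sqrt_add_sub_sqrt_le hc.le ha0
  linarith

/-- **The angular factor**: `∫_{(−π,π)} 1_E ≤ 4h` for the arcs `E` of half-width `h ≤ 1/2`.
[cite: DisertoriRivasseau2000, §IV.1 (IV.13) p0012:L208] -/
private theorem lintegral_angular_le (θs : ℝ) {h : ℝ} (hh0 : 0 ≤ h) (hh : h ≤ 1 / 2) :
    ∫⁻ θ in Ioo (-Real.pi) Real.pi,
        ENNReal.ofReal ({θ : ℝ | ∃ m : ℤ, |θ - θs - 2 * Real.pi * m| ≤ h}.indicator (fun _ => (1 : ℝ)) θ) ≤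
      ENNReal.ofReal (4 * h) := by
  set E : Set ℝ := {θ : ℝ | ∃ m : ℤ, |θ - θs - 2 * Real.pi * m| ≤ h} with hE
  have hEm : MeasurableSet E := by
    have : E = ⋃ m : ℤ, {θ : ℝ | |θ - θs - 2 * Real.pi * m| ≤ h} := by
      ext θ; simp [hE]
    rw [this]
    exact MeasurableSet.iUnion fun m =>
      (isClosed_le ((continuous_id.sub continuous_const).sub continuous_const).abs continuous_const).measurableSet
  have h1 : ∀ θ, ENNReal.ofReal (E.indicator (fun _ => (1 : ℝ)) θ) = E.indicator 1 θ := by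
    intro θ
    by_cases hθ : θ ∈ E
    · simp [Set.indicator_of_mem hθ]
    · simp [Set.indicator_of_notMem hθ]
  simp_rw [h1]
  rw [lintegral_indicator_one hEm, Measure.restrict_apply hEm]
  exact volume_arcs_inter_le θs hh0 hh

/-- **Polar coordinates for the majorant**: a product of a function of the polar angle and a function of `e = |k⃗|² − 1`
integrates (as a Lebesgue integral) to the product of the angular and the radial factors.
[cite: DisertoriRivasseau2000, §IV.1 (IV.12)–(IV.13) p0012:L196–208] -/
private theorem lintegral_polar_eq {E : Set ℝ} (hE : MeasurableSet E) {g : ℝ → ℝ} (hg : Measurable g)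
    (hg0 : ∀ e, 0 ≤ g e) :
    ∫⁻ k : Fin 2 → ℝ, ENNReal.ofReal (E.indicator (fun _ => (1 : ℝ)) (polarAngle k) * g (dispersion k)) =
      (∫⁻ ρ in Ioi (0 : ℝ), ENNReal.ofReal (ρ * g (ρ ^ 2 - 1))) *
        ∫⁻ θ in Ioo (-Real.pi) Real.pi, ENNReal.ofReal (E.indicator (fun _ => (1 : ℝ)) θ) := by
  set Φ : (Fin 2 → ℝ) → ℝ≥0∞ := fun k => ENNReal.ofReal (E.indicator (fun _ => (1 : ℝ)) (polarAngle k) * g (dispersion k))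
    with hΦ
  -- to `ℝ × ℝ`, then to polar coordinates
  have h1 : ∫⁻ k : Fin 2 → ℝ, Φ k = ∫⁻ p : ℝ × ℝ, Φ ((MeasurableEquiv.finTwoArrow (α := ℝ)).symm p) :=
    ((volume_preserving_finTwoArrow ℝ).symm.lintegral_comp_emb (MeasurableEquiv.measurableEmbedding _) Φ).symm
  have h2 : ∫⁻ p : ℝ × ℝ, Φ ((MeasurableEquiv.finTwoArrow (α := ℝ)).symm p) =
      ∫⁻ q in polarCoord.target, ENNReal.ofReal q.1 •
        Φ ((MeasurableEquiv.finTwoArrow (α := ℝ)).symm (polarCoord.symm q)) :=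
    (lintegral_comp_polarCoord_symm _).symm
  rw [h1, h2]
  -- on the target the integrand factorises
  have h3 : ∀ q ∈ polarCoord.target, ENNReal.ofReal q.1 •
      Φ ((MeasurableEquiv.finTwoArrow (α := ℝ)).symm (polarCoord.symm q)) =
        ENNReal.ofReal (q.1 * g (q.1 ^ 2 - 1)) * ENNReal.ofReal (E.indicator (fun _ => (1 : ℝ)) q.2) := by
    rintro ⟨ρ, θ⟩ hq
    rw [polarCoord_target] at hq
    obtain ⟨hρ, hθ⟩ := hq
    rw [mem_Ioi] at hρ
    have hk : (MeasurableEquiv.finTwoArrow (α := ℝ)).symm (polarCoord.symm (ρ, θ)) =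
        ![ρ * Real.cos θ, ρ * Real.sin θ] := by
      ext i; fin_cases i <;> rfl
    have hang : polarAngle ![ρ * Real.cos θ, ρ * Real.sin θ] = θ := by
      unfold polarAngle
      have : momToComplex ![ρ * Real.cos θ, ρ * Real.sin θ] = ρ * (Complex.cos θ + Complex.sin θ * Complex.I) := by
        apply Complex.ext <;> simp [Complex.cos_ofReal_re, Complex.sin_ofReal_re]
      rw [this, Complex.arg_mul_cos_add_sin_mul_I hρ ⟨hθ.1, hθ.2.le⟩]
    have hdisp : dispersion ![ρ * Real.cos θ, ρ * Real.sin θ] = ρ ^ 2 - 1 := by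
      simp [dispersion]
      nlinarith [Real.sin_sq_add_cos_sq θ]
    simp only [hΦ, hk, hang, hdisp, smul_eq_mul]
    rw [← ENNReal.ofReal_mul hρ.le, ← ENNReal.ofReal_mul (mul_nonneg hρ.le (hg0 _))]
    congr 1
    ring
  rw [setLIntegral_congr_fun polarCoord.open_target.measurableSet h3, polarCoord_target, Measure.volume_eq_prod,
    ← Measure.prod_restrict]
  have hm1 : Measurable fun ρ : ℝ => ENNReal.ofReal (ρ * g (ρ ^ 2 - 1)) :=
    (measurable_id.mul (hg.comp ((measurable_id.pow_const 2).sub_const 1))).ennreal_ofReal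
  have hm2 : Measurable fun θ : ℝ => ENNReal.ofReal (E.indicator (fun _ => (1 : ℝ)) θ) :=
    (measurable_const.indicator hE).ennreal_ofReal
  exact lintegral_prod_mul hm1.aemeasurable hm2.aemeasurable

/-- **The Matsubara sum**: with `S` the frequencies `|k₀| ≤ Λ_M` (all others are killed by the cutoff),
`T Σ_{n∈S} |k₀|^{−1/2} ≤ 4Λ_M^{1/2}`. [cite: DisertoriRivasseau2000, §IV.1 (IV.11)–(IV.13) p0012:L196–208] -/
private theorem matsubara_sum_le {T ΛM : ℝ} (hT : 0 < T) (hTM : Real.sqrt 2 * Real.pi * T ≤ ΛM) :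
    ∃ S : Finset ℤ, (∀ n : ℤ, n ∉ S → ΛM < |(2 * (n : ℝ) + 1) * Real.pi * T|) ∧
      T * ∑ n ∈ S, 1 / Real.sqrt |(2 * (n : ℝ) + 1) * Real.pi * T| ≤ 4 * Real.sqrt ΛM := by
  have hπ : 0 < Real.pi := Real.pi_pos
  have hπ3 : 3 < Real.pi := Real.pi_gt_three
  have h2 : (1 : ℝ) < Real.sqrt 2 := by
    rw [show (1 : ℝ) = Real.sqrt 1 by simp]; exact Real.sqrt_lt_sqrt (by norm_num) (by norm_num)
  have h2' : Real.sqrt 2 < 3 / 2 := by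
    rw [show (3 / 2 : ℝ) = Real.sqrt (9 / 4) by
      rw [show (9 / 4 : ℝ) = (3 / 2) ^ 2 by norm_num, Real.sqrt_sq (by norm_num)]]
    exact Real.sqrt_lt_sqrt (by norm_num) (by norm_num)
  have hΛ : 0 < ΛM := lt_of_lt_of_le (by positivity) hTM
  set N : ℕ := ⌊ΛM / (2 * Real.pi * T)⌋₊ with hN
  have hN1 : ΛM / (2 * Real.pi * T) < N + 1 := Nat.lt_floor_add_one _
  have hN2 : ΛM < 2 * Real.pi * T * (N + 1) := by
    rwa [div_lt_iff₀ (by positivity), mul_comm] at hN1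
  set S : Finset ℤ := (Finset.range (N + 1)).image (fun m : ℕ => (m : ℤ)) ∪
    (Finset.range (N + 1)).image (fun m : ℕ => -((m : ℤ) + 1)) with hS
  refine ⟨S, fun n hn => ?_, ?_⟩
  · -- `n ∉ S` ⇒ `|2n+1| ≥ 2N+3`
    have hcases : (N : ℤ) + 1 ≤ n ∨ n ≤ -((N : ℤ) + 2) := by
      by_contra hcon
      push Not at hcon
      apply hn
      rw [hS, Finset.mem_union, Finset.mem_image, Finset.mem_image]
      rcases le_or_gt 0 n with h0 | h0
      · left
        refine ⟨n.toNat, Finset.mem_range.2 ?_, Int.toNat_of_nonneg h0⟩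
        have : (n.toNat : ℤ) = n := Int.toNat_of_nonneg h0
        omega
      · right
        refine ⟨(-n - 1).toNat, Finset.mem_range.2 ?_, ?_⟩
        · have : ((-n - 1).toNat : ℤ) = -n - 1 := Int.toNat_of_nonneg (by omega)
          omega
        · have : ((-n - 1).toNat : ℤ) = -n - 1 := Int.toNat_of_nonneg (by omega)
          omega
    have hge : (2 * (N : ℝ) + 3) * Real.pi * T ≤ |(2 * (n : ℝ) + 1) * Real.pi * T| := by
      rw [abs_mul, abs_mul, abs_of_pos hπ, abs_of_pos hT]
      gcongr
      rcases hcases with h | h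
      · have : (2 * (N : ℝ) + 3) ≤ 2 * (n : ℝ) + 1 := by
          have : ((N : ℤ) : ℝ) + 1 ≤ n := by exact_mod_cast h
          push_cast at this; linarith
        exact this.trans (le_abs_self _)
      · have : (2 * (N : ℝ) + 3) ≤ -(2 * (n : ℝ) + 1) := by
          have : (n : ℝ) ≤ -(((N : ℤ) : ℝ) + 2) := by exact_mod_cast h
          push_cast at this; linarith
        exact this.trans (neg_le_abs _)
    calc ΛM < 2 * Real.pi * T * (N + 1) := hN2
      _ ≤ (2 * (N : ℝ) + 3) * Real.pi * T := by nlinarith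
      _ ≤ _ := hge
  · -- the sum: both halves equal `Σ_{m ≤ N} ((2m+1)πT)^{−1/2} ≤ (πT)^{−1/2} · 2√(N+1)`
    have hdisj : Disjoint ((Finset.range (N + 1)).image (fun m : ℕ => (m : ℤ)))
        ((Finset.range (N + 1)).image (fun m : ℕ => -((m : ℤ) + 1))) := by
      rw [Finset.disjoint_left]
      intro n h1 h2
      rw [Finset.mem_image] at h1 h2
      obtain ⟨m, _, rfl⟩ := h1
      obtain ⟨m', _, hm'⟩ := h2
      omega
    have hinj1 : Set.InjOn (fun m : ℕ => (m : ℤ)) (Finset.range (N + 1) : Set ℕ) := fun a _ b _ h => by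
      simpa using h
    have hinj2 : Set.InjOn (fun m : ℕ => -((m : ℤ) + 1)) (Finset.range (N + 1) : Set ℕ) := fun a _ b _ h => by
      simp only [neg_add_rev] at h; omega
    have hterm : ∀ m : ℕ, 1 / Real.sqrt ((2 * (m : ℝ) + 1) * Real.pi * T) ≤
        1 / Real.sqrt (Real.pi * T) * (1 / Real.sqrt ((m : ℝ) + 1)) := by
      intro m
      rw [one_div_mul_one_div, ← Real.sqrt_mul (by positivity)] -- 1/√(πT (m+1))
      apply one_div_le_one_div_of_le (Real.sqrt_pos.2 (by positivity))
      exact Real.sqrt_le_sqrt (by nlinarith)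
    have hhalf : ∑ m ∈ Finset.range (N + 1), 1 / Real.sqrt ((2 * (m : ℝ) + 1) * Real.pi * T) ≤
        1 / Real.sqrt (Real.pi * T) * (2 * Real.sqrt ((N : ℝ) + 1)) := by
      calc ∑ m ∈ Finset.range (N + 1), 1 / Real.sqrt ((2 * (m : ℝ) + 1) * Real.pi * T)
          ≤ ∑ m ∈ Finset.range (N + 1), 1 / Real.sqrt (Real.pi * T) * (1 / Real.sqrt ((m : ℝ) + 1)) :=
            Finset.sum_le_sum fun m _ => hterm m
        _ = 1 / Real.sqrt (Real.pi * T) * ∑ m ∈ Finset.range (N + 1), 1 / Real.sqrt ((m : ℝ) + 1) := by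
            rw [Finset.mul_sum]
        _ ≤ 1 / Real.sqrt (Real.pi * T) * (2 * Real.sqrt ((N : ℝ) + 1)) :=
            mul_le_mul_of_nonneg_left (sum_inv_sqrt_le N) (by positivity)
    have hsum : ∑ n ∈ S, 1 / Real.sqrt |(2 * (n : ℝ) + 1) * Real.pi * T| ≤
        2 * (1 / Real.sqrt (Real.pi * T) * (2 * Real.sqrt ((N : ℝ) + 1))) := by
      rw [hS, Finset.sum_union hdisj, Finset.sum_image hinj1, Finset.sum_image hinj2]
      have e1 : ∀ m : ℕ, |(2 * ((m : ℤ) : ℝ) + 1) * Real.pi * T| = (2 * (m : ℝ) + 1) * Real.pi * T := fun m => by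
        rw [abs_of_pos (by push_cast; positivity)]; push_cast; ring
      have e2 : ∀ m : ℕ, |(2 * ((-((m : ℤ) + 1) : ℤ) : ℝ) + 1) * Real.pi * T| = (2 * (m : ℝ) + 1) * Real.pi * T :=
        fun m => by
          push_cast
          rw [show (2 * -((m : ℝ) + 1) + 1) * Real.pi * T = -((2 * (m : ℝ) + 1) * Real.pi * T) by ring, abs_neg,
            abs_of_pos (by positivity)]
      simp only [e1, e2]
      linarith [hhalf]
    -- `√(N+1) ≤ √(2Λ_M/(πT))`, and the arithmetic
    have hN3 : (N : ℝ) + 1 ≤ 2 * ΛM / (Real.pi * T) := by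
      have hNle : (N : ℝ) ≤ ΛM / (2 * Real.pi * T) := Nat.floor_le (by positivity)
      rw [le_div_iff₀ (by positivity)]
      rw [le_div_iff₀ (by positivity)] at hNle
      nlinarith
    have hsq : Real.sqrt ((N : ℝ) + 1) ≤ Real.sqrt (2 * ΛM) / Real.sqrt (Real.pi * T) := by
      rw [← Real.sqrt_div (by positivity)]
      exact Real.sqrt_le_sqrt hN3
    have hpt : 0 < Real.sqrt (Real.pi * T) := Real.sqrt_pos.2 (by positivity)
    calc T * ∑ n ∈ S, 1 / Real.sqrt |(2 * (n : ℝ) + 1) * Real.pi * T|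
        ≤ T * (2 * (1 / Real.sqrt (Real.pi * T) * (2 * Real.sqrt ((N : ℝ) + 1)))) :=
          mul_le_mul_of_nonneg_left hsum hT.le
      _ ≤ T * (2 * (1 / Real.sqrt (Real.pi * T) * (2 * (Real.sqrt (2 * ΛM) / Real.sqrt (Real.pi * T))))) := by
          gcongr
      _ = 4 * Real.sqrt (2 * ΛM) * (T / (Real.sqrt (Real.pi * T) * Real.sqrt (Real.pi * T))) := by
          field_simp
          ring
      _ = 4 * Real.sqrt (2 * ΛM) / Real.pi := by
          rw [Real.mul_self_sqrt (by positivity)]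
          field_simp
      _ = (4 * Real.sqrt 2 / Real.pi) * Real.sqrt ΛM := by
          rw [Real.sqrt_mul (by norm_num)]; ring
      _ ≤ 4 * Real.sqrt ΛM := by
          have : 4 * Real.sqrt 2 / Real.pi ≤ 4 := by
            rw [div_le_iff₀ hπ]; nlinarith
          exact mul_le_mul_of_nonneg_right this (Real.sqrt_nonneg _)

/-! ## 4. The discharge -/

set_option maxHeartbeats 400000 in
/-- **DR 2000 Part I, §IV.1 Lemma 4 (IV.11) — PROVED** (discharge of the named fact `Lemma4SectorSliceNorm`, cell
F-044): for every cutoff `u` of (II.13) there is `K > 0` with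
`(T/(2π)²) Σ_n ∫d²k χ_{θ_s}(k⃗)² (k₀²+e²(k⃗))^{−1/2} [u(r/Λ_M²) − u(r/Λ_m²)] ≤ K Λ_M^{1/2}(Λ_M − Λ_m)`, `r = k₀² + e²`,
`k₀ = (2n+1)πT`, for all `0 < T`, `√2πT ≤ Λ_m ≤ Λ_M ≤ 1` and all `θ_s` («‖F_f‖²_𝒞 ≤ K Λ^{1/2}(w_M)[Λ(w_M) − Λ(w_{𝒜(m)})]»).
Proof = slice factor (mean value theorem) × sectorised shell size in polar coordinates × Matsubara sum, see the module
docstring. [cite: DisertoriRivasseau2000, §IV.1 Lemma 4 (IV.4)–(IV.13) p0012:L98–110, p0012:L157–208] -/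
theorem Lemma4SectorSliceNorm_holds : Lemma4SectorSliceNorm := by
  intro u hu
  obtain ⟨M, hM1, hM₀, hM₁⟩ := cutoff_bounds hu
  have hMpos : 0 < M := by linarith
  refine ⟨400 * M ^ 3, by positivity, ?_⟩
  intro T Λm ΛM θs hT hTm hmM hM1'
  have hπ : 0 < Real.pi := Real.pi_pos
  have hπ3 : 3 < Real.pi := Real.pi_gt_three
  have hm : 0 < Λm := lt_of_lt_of_le (by positivity) hTm
  have hΛ : 0 < ΛM := hm.trans_le hmM
  have hTM : Real.sqrt 2 * Real.pi * T ≤ ΛM := hTm.trans hmM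
  -- the sector width `w = α^{1/4} = Λ_M^{−1/2}` and the arc half-width `1/(2w) = √Λ_M/2`
  set w : ℝ := (1 / ΛM ^ 2) ^ (1 / 4 : ℝ) with hwdef
  have hw_eq : w = 1 / Real.sqrt ΛM := by
    have h4 : 1 / ΛM ^ 2 = (1 / Real.sqrt ΛM) ^ 4 := by
      rw [div_pow, one_pow, show (4 : ℕ) = 2 * 2 from rfl, pow_mul, Real.sq_sqrt hΛ.le]
    rw [hwdef, h4, show (1 / 4 : ℝ) = ((4 : ℕ) : ℝ)⁻¹ by norm_num,
      Real.pow_rpow_inv_natCast (by positivity) (by norm_num)]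
  have hw : 0 < w := by rw [hw_eq]; positivity
  have hsqΛ : 0 < Real.sqrt ΛM := Real.sqrt_pos.2 hΛ
  have hsqΛ1 : Real.sqrt ΛM ≤ 1 := by rw [show (1:ℝ) = Real.sqrt 1 by simp]; exact Real.sqrt_le_sqrt hM1'
  have hτ : 1 < 2 * Real.pi * w := by
    rw [hw_eq]
    have : 1 ≤ 1 / Real.sqrt ΛM := by rw [le_div_iff₀ hsqΛ]; linarith
    nlinarith
  have hh : 1 / (2 * w) = Real.sqrt ΛM / 2 := by rw [hw_eq]; field_simp
  set E : Set ℝ := {θ : ℝ | ∃ m : ℤ, |θ - θs - 2 * Real.pi * m| ≤ 1 / (2 * w)} with hEdef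
  have hEm : MeasurableSet E := by
    have : E = ⋃ m : ℤ, {θ : ℝ | |θ - θs - 2 * Real.pi * m| ≤ 1 / (2 * w)} := by ext θ; simp [hEdef]
    rw [this]
    exact MeasurableSet.iUnion fun m =>
      (isClosed_le ((continuous_id.sub continuous_const).sub continuous_const).abs continuous_const).measurableSet
  -- the Matsubara frequencies and the finite set of relevant ones
  obtain ⟨S, hS, hSsum⟩ := matsubara_sum_le hT hTM
  have hk0 : ∀ (n : ℤ) (k : Fin 2 → ℝ), (matsubaraMom T n k).1 = (2 * (n : ℝ) + 1) * Real.pi * T :=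
    fun n k => matsubaraMom_fst T n k
  have hrOf : ∀ (n : ℤ) (k : Fin 2 → ℝ),
      rOf (matsubaraMom T n k) = ((2 * (n : ℝ) + 1) * Real.pi * T) ^ 2 + dispersion k ^ 2 := by
    intro n k; rw [rOf, hk0]; rfl
  have hcpos : ∀ n : ℤ, 0 < |(2 * (n : ℝ) + 1) * Real.pi * T| := by
    intro n
    rw [abs_pos]
    have : (2 * (n : ℝ) + 1) ≠ 0 := by
      intro h
      have h2 : (2 * n + 1 : ℤ) = 0 := by exact_mod_cast h
      omega
    positivity
  -- abbreviation for the integrand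
  set f : ℤ → (Fin 2 → ℝ) → ℝ := fun n k =>
    sectorChiMom u (1 / ΛM ^ 2) θs k ^ 2 / Real.sqrt (rOf (matsubaraMom T n k)) *
      bandCutoff u Λm ΛM (rOf (matsubaraMom T n k)) with hfdef
  -- (A) frequencies outside `S` contribute nothing
  have hzero : ∀ n : ℤ, n ∉ S → (fun k => f n k) = fun _ => 0 := by
    intro n hn
    funext k
    have hr : ΛM ^ 2 / 2 < rOf (matsubaraMom T n k) := by
      rw [hrOf]
      have h1 : ΛM ^ 2 < ((2 * (n : ℝ) + 1) * Real.pi * T) ^ 2 := by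
        have := hS n hn
        calc ΛM ^ 2 < |(2 * (n : ℝ) + 1) * Real.pi * T| ^ 2 := by gcongr
          _ = _ := sq_abs _
      nlinarith [sq_nonneg (dispersion k)]
    simp only [hfdef, bandCutoff_eq_zero_of_lt hu hm hmM hr, mul_zero]
  have htsum : ∑' n : ℤ, ∫ k, f n k = ∑ n ∈ S, ∫ k, f n k := by
    refine tsum_eq_sum fun n hn => ?_
    rw [hzero n hn, integral_zero]
  -- (B) the bound for one frequency
  have hone : ∀ n : ℤ, ∫ k, f n k ≤
      48 * Real.sqrt 2 * M ^ 3 * (ΛM - Λm) * (1 / Real.sqrt |(2 * (n : ℝ) + 1) * Real.pi * T|) := by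
    intro n
    set c : ℝ := |(2 * (n : ℝ) + 1) * Real.pi * T| with hcdef
    have hc : 0 < c := hcpos n
    set g : ℝ → ℝ := fun e => (Icc (-ΛM) ΛM).indicator (fun e => 1 / Real.sqrt (c + |e|)) e with hgdef
    have hg0 : ∀ e, 0 ≤ g e := fun e => Set.indicator_nonneg (fun _ _ => by positivity) _
    have hgm : Measurable g := by
      refine Measurable.indicator ?_ measurableSet_Icc
      exact (measurable_const.div (Real.continuous_sqrt.measurable.comp (measurable_const.add
        (continuous_abs.measurable)))).comp measurable_id
    set D : ℝ := 4 * M * ((ΛM - Λm) / ΛM) * M ^ 2 * (Real.sqrt 2 / Real.sqrt c) with hDdef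
    have hD0 : 0 ≤ D := by
      have : 0 ≤ (ΛM - Λm) / ΛM := div_nonneg (by linarith) hΛ.le
      positivity
    set F : (Fin 2 → ℝ) → ℝ := fun k => D * (E.indicator (fun _ => (1 : ℝ)) (polarAngle k) * g (dispersion k))
      with hFdef
    have hF0 : ∀ k, 0 ≤ F k := fun k =>
      mul_nonneg hD0 (mul_nonneg (Set.indicator_nonneg (fun _ _ => zero_le_one) _) (hg0 _))
    have hpolar : Measurable polarAngle :=
      Complex.measurable_arg.comp (contDiff_momToComplex (m := 0)).continuous.measurable
    have hdispm : Measurable dispersion := by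
      unfold dispersion; fun_prop
    have hFm : Measurable F := by
      simp only [hFdef]
      exact measurable_const.mul (((measurable_const.indicator hEm).comp hpolar).mul (hgm.comp hdispm))
    -- (B1) pointwise domination `‖f n k‖ ≤ F k`
    have hdom : ∀ k, ‖f n k‖ ≤ F k := by
      intro k
      by_cases hr : ΛM ^ 2 / 2 < rOf (matsubaraMom T n k)
      · simp only [hfdef, bandCutoff_eq_zero_of_lt hu hm hmM hr, mul_zero, norm_zero]; exact hF0 k
      rw [not_lt] at hr
      have hr0 : 0 ≤ rOf (matsubaraMom T n k) := by rw [hrOf]; positivity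
      have hrpos : 0 < rOf (matsubaraMom T n k) := by
        rw [hrOf, ← sq_abs ((2 * (n : ℝ) + 1) * Real.pi * T), ← hcdef]; positivity
      have he : |dispersion k| ≤ ΛM := by
        have h1 : dispersion k ^ 2 ≤ ΛM ^ 2 := by
          have : dispersion k ^ 2 ≤ rOf (matsubaraMom T n k) := by rw [hrOf]; nlinarith
          nlinarith
        exact abs_le.2 (abs_le_of_sq_le_sq' h1 hΛ.le)
      have hge : g (dispersion k) = 1 / Real.sqrt (c + |dispersion k|) := by
        simp only [hgdef, Set.indicator_of_mem (show dispersion k ∈ Icc (-ΛM) ΛM from abs_le.1 he)]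
      have hA0 : 0 ≤ M ^ 2 * E.indicator (fun _ => (1 : ℝ)) (polarAngle k) :=
        mul_nonneg (sq_nonneg _) (Set.indicator_nonneg (fun _ _ => zero_le_one) _)
      -- the three factors
      have hχ2 : sectorChiMom u (1 / ΛM ^ 2) θs k ^ 2 ≤ M ^ 2 * E.indicator (fun _ => (1 : ℝ)) (polarAngle k) := by
        simp only [sectorChiMom]
        exact sectorChi_sq_le hu hMpos.le hM₀ hw hτ θs (polarAngle k) rfl
      have hsqrt : 1 / Real.sqrt (rOf (matsubaraMom T n k)) ≤
          Real.sqrt 2 / (Real.sqrt c * Real.sqrt (c + |dispersion k|)) := by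
        have hprod : Real.sqrt c * Real.sqrt (c + |dispersion k|) ≤
            Real.sqrt 2 * Real.sqrt (rOf (matsubaraMom T n k)) := by
          rw [← Real.sqrt_mul hc.le, ← Real.sqrt_mul (by norm_num)]
          apply Real.sqrt_le_sqrt
          rw [hrOf, ← sq_abs ((2 * (n : ℝ) + 1) * Real.pi * T), ← hcdef]
          nlinarith [abs_nonneg (dispersion k), sq_abs (dispersion k), sq_nonneg (c - |dispersion k|)]
        rw [div_le_div_iff₀ (Real.sqrt_pos.2 hrpos) (by positivity), one_mul]
        exact hprod
      have hB : |bandCutoff u Λm ΛM (rOf (matsubaraMom T n k))| ≤ 4 * M * ((ΛM - Λm) / ΛM) :=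
        abs_bandCutoff_le hu hM1 hM₀ hM₁ hm hmM hr0
      have hnorm : ‖f n k‖ = sectorChiMom u (1 / ΛM ^ 2) θs k ^ 2 * (1 / Real.sqrt (rOf (matsubaraMom T n k))) *
          |bandCutoff u Λm ΛM (rOf (matsubaraMom T n k))| := by
        simp only [hfdef, Real.norm_eq_abs, abs_mul, abs_div, abs_pow, sq_abs, abs_of_nonneg (Real.sqrt_nonneg _)]
        ring
      rw [hnorm]
      calc sectorChiMom u (1 / ΛM ^ 2) θs k ^ 2 * (1 / Real.sqrt (rOf (matsubaraMom T n k))) *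
            |bandCutoff u Λm ΛM (rOf (matsubaraMom T n k))|
          ≤ (M ^ 2 * E.indicator (fun _ => (1 : ℝ)) (polarAngle k)) *
              (Real.sqrt 2 / (Real.sqrt c * Real.sqrt (c + |dispersion k|))) * (4 * M * ((ΛM - Λm) / ΛM)) :=
            mul_le_mul (mul_le_mul hχ2 hsqrt (by positivity) hA0) hB (abs_nonneg _) (mul_nonneg hA0 (by positivity))
        _ = F k := by
            simp only [hFdef, hDdef, hge]
            ring
    -- (B2) the Lebesgue integral of the majorant in polar coordinates
    have hprodm : Measurable fun k : Fin 2 → ℝ => E.indicator (fun _ => (1 : ℝ)) (polarAngle k) * g (dispersion k) :=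
      ((measurable_const.indicator hEm).comp hpolar).mul (hgm.comp hdispm)
    have hlin : ∫⁻ k, ENNReal.ofReal (F k) ≤ ENNReal.ofReal (D * (6 * Real.sqrt ΛM) * (2 * Real.sqrt ΛM)) := by
      have h1 : ∀ k, ENNReal.ofReal (F k) =
          ENNReal.ofReal D * ENNReal.ofReal (E.indicator (fun _ => (1 : ℝ)) (polarAngle k) * g (dispersion k)) :=
        fun k => by simp only [hFdef]; rw [ENNReal.ofReal_mul hD0]
      simp_rw [h1]
      rw [lintegral_const_mul _ hprodm.ennreal_ofReal, lintegral_polar_eq hEm hgm hg0,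
        ENNReal.ofReal_mul (mul_nonneg hD0 (by positivity)), ENNReal.ofReal_mul hD0, mul_assoc]
      refine mul_le_mul' le_rfl (mul_le_mul' ?_ ?_)
      · -- radial factor
        simpa only [hgdef] using lintegral_radial_le hc hΛ.le hM1'
      · -- angular factor
        rw [hEdef]
        calc ∫⁻ θ in Ioo (-Real.pi) Real.pi, ENNReal.ofReal
              ({θ : ℝ | ∃ m : ℤ, |θ - θs - 2 * Real.pi * m| ≤ 1 / (2 * w)}.indicator (fun _ => (1 : ℝ)) θ)
            ≤ ENNReal.ofReal (4 * (1 / (2 * w))) :=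
              lintegral_angular_le θs (by positivity) (by rw [hh]; linarith)
          _ = ENNReal.ofReal (2 * Real.sqrt ΛM) := by rw [hh]; congr 1; ring
    -- (B3) integrability of the majorant and the Bochner bound
    have hFint : Integrable F := by
      refine ⟨hFm.aestronglyMeasurable, ?_⟩
      rw [hasFiniteIntegral_iff_ofReal (Filter.Eventually.of_forall hF0)]
      exact hlin.trans_lt ENNReal.ofReal_lt_top
    have hintF : ∫ k, F k ≤ D * (6 * Real.sqrt ΛM) * (2 * Real.sqrt ΛM) := by
      rw [integral_eq_lintegral_of_nonneg_ae (Filter.Eventually.of_forall hF0) hFm.aestronglyMeasurable]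
      exact ENNReal.toReal_le_of_le_ofReal (mul_nonneg (mul_nonneg hD0 (by positivity)) (by positivity)) hlin
    calc ∫ k, f n k ≤ ‖∫ k, f n k‖ := Real.le_norm_self _
      _ ≤ ∫ k, F k := norm_integral_le_of_norm_le hFint (Filter.Eventually.of_forall hdom)
      _ ≤ D * (6 * Real.sqrt ΛM) * (2 * Real.sqrt ΛM) := hintF
      _ = 48 * Real.sqrt 2 * M ^ 3 * (ΛM - Λm) * (1 / Real.sqrt c) := by
          rw [show D * (6 * Real.sqrt ΛM) * (2 * Real.sqrt ΛM) = 12 * D * (Real.sqrt ΛM * Real.sqrt ΛM) by ring,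
            Real.mul_self_sqrt hΛ.le, hDdef]
          have hΛne : ΛM ≠ 0 := hΛ.ne'
          field_simp
          ring
  -- (C) sum over the frequencies
  have h2 : Real.sqrt 2 ≤ 2 := by
    rw [show (2 : ℝ) = Real.sqrt 4 by rw [show (4:ℝ) = 2 ^ 2 by norm_num, Real.sqrt_sq (by norm_num)]]
    exact Real.sqrt_le_sqrt (by norm_num)
  have hπsq : 9 < Real.pi ^ 2 := by nlinarith
  rw [htsum]
  calc T / (2 * Real.pi) ^ 2 * ∑ n ∈ S, ∫ k, f n k
      ≤ T / (2 * Real.pi) ^ 2 * ∑ n ∈ S,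
          48 * Real.sqrt 2 * M ^ 3 * (ΛM - Λm) * (1 / Real.sqrt |(2 * (n : ℝ) + 1) * Real.pi * T|) :=
        mul_le_mul_of_nonneg_left (Finset.sum_le_sum fun n _ => hone n) (by positivity)
    _ = 48 * Real.sqrt 2 * M ^ 3 * (ΛM - Λm) / (2 * Real.pi) ^ 2 *
          (T * ∑ n ∈ S, 1 / Real.sqrt |(2 * (n : ℝ) + 1) * Real.pi * T|) := by
        rw [← Finset.mul_sum]; ring
    _ ≤ 48 * Real.sqrt 2 * M ^ 3 * (ΛM - Λm) / (2 * Real.pi) ^ 2 * (4 * Real.sqrt ΛM) := by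
        apply mul_le_mul_of_nonneg_left hSsum
        have : 0 ≤ ΛM - Λm := by linarith
        positivity
    _ ≤ 400 * M ^ 3 * ΛM ^ (1 / 2 : ℝ) * (ΛM - Λm) := by
        rw [← Real.sqrt_eq_rpow]
        have h3 : 0 ≤ ΛM - Λm := by linarith
        have h4 : 48 * Real.sqrt 2 * 4 / (2 * Real.pi) ^ 2 ≤ 400 := by
          rw [div_le_iff₀ (by positivity)]; nlinarith [h2, hπsq]
        have h5 : 0 ≤ M ^ 3 * Real.sqrt ΛM * (ΛM - Λm) := by positivity
        calc 48 * Real.sqrt 2 * M ^ 3 * (ΛM - Λm) / (2 * Real.pi) ^ 2 * (4 * Real.sqrt ΛM)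
            = (48 * Real.sqrt 2 * 4 / (2 * Real.pi) ^ 2) * (M ^ 3 * Real.sqrt ΛM * (ΛM - Λm)) := by ring
          _ ≤ 400 * (M ^ 3 * Real.sqrt ΛM * (ΛM - Λm)) := mul_le_mul_of_nonneg_right h4 h5
          _ = 400 * M ^ 3 * Real.sqrt ΛM * (ΛM - Λm) := by ring

end Literature.MathematicalPhysics.QuantumLattice.FermiRG.DR2000

end
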